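import Mathlib
import Summits.PneNP.PneNP.Theorems.Nc03AvoidResidualCoreReductionBfsP4

/-!
# Route Nc03AvoidResidualCore, item `ResidualCoreReduction` — the solver, XIII: packing and flipping are polynomial time

Helper file for `stmt-PneNP-20227` (sequel of `…ReductionBfsP4`; cell pnp-ideate). `CodeFP` proofs
for the packing programs: `hasNF`, `seedP`, `zmemP`, the packing step (three bit strings of length
at most the input size — a fixed-size accumulator for `CodeFP.iterateInv`), the run, `packUnionP`,
`packColP`, `sdiffZP` and the candidate patterns `flipColP`.
-/

set_option linter.dupNamespace false -- `Summit.PneNP.PneNP.…`: summit = sub-problem name (D-0017 single-conjunct layout)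

namespace Summit.PneNP.PneNP.Theorems.Nc03Reduction

open Literature.Computability.Complexity CodeFP

/-- The code of a packing state. -/
abbrev pstE : PSt → List Bool := pairE strE (pairE strE strE)

/-- The edge count is polynomial time (unary). -/
theorem codeFP_mP : CodeFP gdE unE mP := ((ulength tripE).comp (snd _ _)).congr fun _ => rfl

/-- The non-forest test is polynomial time. -/
theorem codeFP_hasNF : CodeFP ceE bitE (fun q => hasNF q.1 q.2) := by
  have hp : CodeFP (pairE ceE natE) bitE (fun y => y.1.2.getD y.2 false && !inForestP y.1.1 y.1.2 y.2) :=
    ((strGetDNat.comp ((fst _ _).snd'.pair (snd _ _))).and codeFP_inForestP.not).congr fun _ => rfl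
  exact ((any hp).comp ((CodeFP.id _).pair (urange.comp (codeFP_mP.comp (fst _ _))))).congr fun _ => rfl

/-- The seed is polynomial time. -/
theorem codeFP_seedP : CodeFP ceE natE (fun q => seedP q.1 q.2) := by
  have hp : CodeFP (pairE ceE natE) bitE (fun y => y.1.2.getD y.2 false && !inForestP y.1.1 y.1.2 y.2) :=
    ((strGetDNat.comp ((fst _ _).snd'.pair (snd _ _))).and codeFP_inForestP.not).congr fun _ => rfl
  have hf : CodeFP ceE (optE natE) (fun q => (List.range (mP q.1)).find? fun j => q.2.getD j false && !inForestP q.1 q.2 j) :=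
    ((rawFind? hp).comp ((CodeFP.id _).pair (urange.comp (codeFP_mP.comp (fst _ _))))).congr fun _ => rfl
  exact ((optGetD natE).comp (hf.pair (const _ 0))).congr fun _ => rfl

/-- Cycle membership is polynomial time. -/
theorem codeFP_zmemP : CodeFP (pairE ceeE natE) bitE (fun q => zmemP q.1.1.1 q.1.1.2 q.1.2 q.2) :=
  ((mem natE_injective).comp ((snd _ _).pair (codeFP_fcycListP.comp (fst _ _)))).congr fun _ => rfl

/-- Context for the step items: `((gd, st), j)`; the current `(gd, E)` pair. -/
theorem codeFP_stCe : CodeFP (pairE (pairE gdE pstE) natE) ceE (fun y => (y.1.1, y.1.2.1)) :=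
  (fst _ _).fst'.pair (fst _ _).snd'.fst'

/-- The packing step is polynomial time. -/
theorem codeFP_packStepP : CodeFP (pairE gdE pstE) pstE (fun q => packStepP q.1 q.2) := by
  -- item-level maps in context `((gd, st), j)`
  have hce := codeFP_stCe
  have hseed : CodeFP (pairE (pairE gdE pstE) natE) natE (fun y => seedP y.1.1 y.1.2.1) :=
    (codeFP_seedP.comp hce).congr fun _ => rfl
  have hz : CodeFP (pairE (pairE gdE pstE) natE) bitE (fun y => zmemP y.1.1 y.1.2.1 (seedP y.1.1 y.1.2.1) y.2) :=
    (codeFP_zmemP.comp ((hce.pair hseed).pair (snd _ _))).congr fun _ => rfl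
  have hfc : CodeFP (pairE (pairE gdE pstE) natE) bitE (fun y => fcolP y.1.1 y.1.2.1 (seedP y.1.1 y.1.2.1) y.2) :=
    (codeFP_fcolP.comp ((hce.pair hseed).pair (snd _ _))).congr fun _ => rfl
  have g1 : CodeFP (pairE (pairE gdE pstE) natE) bitE (fun y => y.1.2.1.getD y.2 false) :=
    strGetDNat.comp ((fst _ _).snd'.fst'.pair (snd _ _))
  have g2 : CodeFP (pairE (pairE gdE pstE) natE) bitE (fun y => y.1.2.2.1.getD y.2 false) :=
    strGetDNat.comp ((fst _ _).snd'.snd'.fst'.pair (snd _ _))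
  have g3 : CodeFP (pairE (pairE gdE pstE) natE) bitE (fun y => y.1.2.2.2.getD y.2 false) :=
    strGetDNat.comp ((fst _ _).snd'.snd'.snd'.pair (snd _ _))
  have i1 : CodeFP (pairE (pairE gdE pstE) natE) bitE
      (fun y => y.1.2.1.getD y.2 false && !zmemP y.1.1 y.1.2.1 (seedP y.1.1 y.1.2.1) y.2) := (g1.and hz.not).congr fun _ => rfl
  have i2 : CodeFP (pairE (pairE gdE pstE) natE) bitE
      (fun y => y.1.2.2.1.getD y.2 false || zmemP y.1.1 y.1.2.1 (seedP y.1.1 y.1.2.1) y.2) := (g2.or hz).congr fun _ => rfl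
  have i3 : CodeFP (pairE (pairE gdE pstE) natE) bitE
      (fun y => if zmemP y.1.1 y.1.2.1 (seedP y.1.1 y.1.2.1) y.2 then fcolP y.1.1 y.1.2.1 (seedP y.1.1 y.1.2.1) y.2
        else y.1.2.2.2.getD y.2 false) := (CodeFP.ite hz hfc g3).congr fun _ => rfl
  have hr : CodeFP (pairE gdE pstE) (rawE natE) (fun q => List.range (mP q.1)) := urange.comp (codeFP_mP.comp (fst _ _))
  have m1 := (bitsToStr.comp ((map i1).comp ((CodeFP.id _).pair hr))).congr (fun _ => rfl)
  have m2 := (bitsToStr.comp ((map i2).comp ((CodeFP.id _).pair hr))).congr (fun _ => rfl)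
  have m3 := (bitsToStr.comp ((map i3).comp ((CodeFP.id _).pair hr))).congr (fun _ => rfl)
  have hcond : CodeFP (pairE gdE pstE) bitE (fun q => hasNF q.1 q.2.1) :=
    (codeFP_hasNF.comp ((fst _ _).pair (snd _ _).fst')).congr fun _ => rfl
  exact (CodeFP.ite hcond (m1.pair (m2.pair m3)) (snd _ _)).congr fun q => by
    unfold packStepP; rfl

/-- Lengths along the packing run stay bounded by the input. -/
theorem length_packStepP (gd : GD) (st : PSt) (B : ℕ) (hB : mP gd ≤ B)
    (h : st.1.length ≤ B ∧ st.2.1.length ≤ B ∧ st.2.2.length ≤ B) :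
    (packStepP gd st).1.length ≤ B ∧ (packStepP gd st).2.1.length ≤ B ∧ (packStepP gd st).2.2.length ≤ B := by
  unfold packStepP
  split
  · simp only [List.length_map, List.length_range]; exact ⟨hB, hB, hB⟩
  · exact h

/-- Graph data codes are at least as long as the edge count. -/
theorem mP_le_length_gdE (gd : GD) : mP gd ≤ (gdE gd).length := by
  unfold gdE mP
  rw [pairE_apply, length_boolPair]
  have := length_le_length_rawE tripE gd.2
  omega

/-- **The packing run is polynomial time** (step count in unary). -/
theorem codeFP_packRunP : CodeFP (pairE ceE unE) pstE (fun q => packRunP q.1.1 q.1.2 q.2) := by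
  have hF : CodeFP (pairE (pairE ceE unE) pstE) pstE (fun t => packStepP t.1.1.1 t.2) :=
    (codeFP_packStepP.comp ((fst _ _).fst'.fst'.pair (snd _ _))).congr fun _ => rfl
  have hzeros : CodeFP (pairE ceE unE) strE (fun s => zerosP s.1.1) :=
    (bitsToStr.comp ((map (σ := (GD × List Bool) × ℕ) (eσ := pairE ceE unE) (g := fun _ => false)
      (const _ false)).comp ((CodeFP.id _).pair (urange.comp (codeFP_mP.comp (fst _ _).fst'))))).congr
      fun _ => rfl
  have hinit : CodeFP (pairE ceE unE) pstE (fun s => (s.1.2, zerosP s.1.1, zerosP s.1.1)) :=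
    (fst _ _).snd'.pair (hzeros.pair hzeros)
  have h := iterateInv (σ := (GD × List Bool) × ℕ) (β := PSt) (eσ := pairE ceE unE) (eβ := pstE)
    (F := fun s st => packStepP s.1.1 st) (init := fun s => (s.1.2, zerosP s.1.1, zerosP s.1.1)) (k := fun s => s.2)
    (fun s _ st => st.1.length ≤ (pairE ceE unE s).length ∧ st.2.1.length ≤ (pairE ceE unE s).length ∧
      st.2.2.length ≤ (pairE ceE unE s).length)
    hF hinit (snd _ _)
    (fun s => by
      have h1 := mP_le_length_gdE s.1.1
      have h2 : (gdE s.1.1).length ≤ (pairE ceE unE s).length ∧ s.1.2.length ≤ (pairE ceE unE s).length := by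
        simp only [pairE_apply, length_boolPair, strE, id]; constructor <;> omega
      simp only [zerosP, List.length_map, List.length_range]
      exact ⟨h2.2, by omega, by omega⟩)
    (fun s _ st hst => length_packStepP _ _ _ (by
      have h1 := mP_le_length_gdE s.1.1
      have : (gdE s.1.1).length ≤ (pairE ceE unE s).length := by
        simp only [pairE_apply, length_boolPair, strE, id]; omega
      omega) hst)
    (5 * Polynomial.X + 4) (fun s j st hst => by
      simp only [Polynomial.eval_add, Polynomial.eval_mul, Polynomial.eval_ofNat, Polynomial.eval_X, pairE_apply,
        length_boolPair, strE, id]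
      obtain ⟨a, b, c⟩ := hst
      simp only [pairE_apply, length_boolPair, strE, id] at a b c
      omega)
  exact h.congr fun _ => rfl

/-- The packing union is polynomial time. -/
theorem codeFP_packUnionP : CodeFP ceE strE (fun q => packUnionP q.1 q.2) :=
  (codeFP_packRunP.comp ((CodeFP.id _).pair (codeFP_mP.comp (fst _ _)))).snd'.fst'.congr fun _ => rfl

/-- The packing pattern is polynomial time. -/
theorem codeFP_packColP : CodeFP ceE strE (fun q => packColP q.1 q.2) :=
  (codeFP_packRunP.comp ((CodeFP.id _).pair (codeFP_mP.comp (fst _ _)))).snd'.snd'.congr fun _ => rfl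

/-- The set difference by the cycle is polynomial time. -/
theorem codeFP_sdiffZP : CodeFP ceeE strE (fun q => sdiffZP q.1.1 q.1.2 q.2) := by
  have hi : CodeFP (pairE ceeE natE) bitE (fun y => y.1.1.2.getD y.2 false && !zmemP y.1.1.1 y.1.1.2 y.1.2 y.2) :=
    ((strGetDNat.comp ((fst _ _).fst'.snd'.pair (snd _ _))).and codeFP_zmemP.not).congr fun _ => rfl
  exact (bitsToStr.comp ((map hi).comp ((CodeFP.id _).pair (urange.comp (codeFP_mP.comp (fst _ _).fst'))))).congr
    fun _ => rfl

/-- **The candidate patterns are polynomial time.** -/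
theorem codeFP_flipColP : CodeFP (pairE ceeE bitE) strE (fun q => flipColP q.1.1.1 q.1.1.2 q.1.2 q.2) := by
  -- item context `((cee, b), j)`
  have hz : CodeFP (pairE (pairE ceeE bitE) natE) bitE (fun y => zmemP y.1.1.1.1 y.1.1.1.2 y.1.1.2 y.2) :=
    (codeFP_zmemP.comp ((fst _ _).fst'.pair (snd _ _))).congr fun _ => rfl
  have hfc : CodeFP (pairE (pairE ceeE bitE) natE) bitE (fun y => fcolP y.1.1.1.1 y.1.1.1.2 y.1.1.2 y.2) :=
    (codeFP_fcolP.comp ((fst _ _).fst'.pair (snd _ _))).congr fun _ => rfl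
  have hx : CodeFP (pairE (pairE ceeE bitE) natE) bitE (fun y => xor (fcolP y.1.1.1.1 y.1.1.1.2 y.1.1.2 y.2) y.1.2) :=
    (hfc.xor (fst _ _).snd').congr fun _ => rfl
  have hpc : CodeFP (pairE (pairE ceeE bitE) natE) strE
      (fun y => packColP y.1.1.1.1 (sdiffZP y.1.1.1.1 y.1.1.1.2 y.1.1.2)) :=
    (codeFP_packColP.comp ((fst _ _).fst'.fst'.fst'.pair (codeFP_sdiffZP.comp (fst _ _).fst'))).congr fun _ => rfl
  have helse : CodeFP (pairE (pairE ceeE bitE) natE) bitE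
      (fun y => (packColP y.1.1.1.1 (sdiffZP y.1.1.1.1 y.1.1.1.2 y.1.1.2)).getD y.2 false) :=
    (strGetDNat.comp (hpc.pair (snd _ _))).congr fun _ => rfl
  have hi : CodeFP (pairE (pairE ceeE bitE) natE) bitE
      (fun y => if zmemP y.1.1.1.1 y.1.1.1.2 y.1.1.2 y.2 then xor (fcolP y.1.1.1.1 y.1.1.1.2 y.1.1.2 y.2) y.1.2
        else (packColP y.1.1.1.1 (sdiffZP y.1.1.1.1 y.1.1.1.2 y.1.1.2)).getD y.2 false) :=
    (CodeFP.ite hz hx helse).congr fun _ => rfl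
  exact (bitsToStr.comp ((map hi).comp ((CodeFP.id _).pair
    (urange.comp (codeFP_mP.comp (fst _ _).fst'.fst'))))).congr fun _ => rfl

end Summit.PneNP.PneNP.Theorems.Nc03Reduction
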